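import Summits.CriticalPhenomena.CardyFormulaZ2.Theses.CardyDualCurrent
import Summits.CriticalPhenomena.CardyFormulaZ2.Cruxes.DualCurrentTemplateR.Lines.birth
import Literature.Probability.LatticeModels.LocalParafermionicTemplate
import HarnessLib

/-!
# Strategist r1 census signatures — crux `CardyDualCurrent.DualCurrentTemplateR`
(item `stmt-CriticalPhenomena-11201`; redirect strategist `cstrat-stmt-CriticalPhenomena-11201-r1`,
2026-08-17).  Companion of `STRATEGY-CENSUS-r1.md`: every signature quoted in the census is typed
here and shown (sorry-free) to feed the crux BY NAME, so that the census's "no leverage" verdicts are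
about real statements.  Read-only import of the live skeleton `Lines/birth.lean` (r2); the two stub signatures of the
sibling negation line `CanonicalLimitFromExactCR/Lines/local_necessity.lean` (r4, strategist s1 on
stmt-11394) are restated VERBATIM (`LocalNecessity`, `ConjectureH`) rather than imported, that module
not being built on the farm at check time; nothing here is a line, nothing is registered, nothing
touches the lead's files.
-/

noncomputable section

namespace Summit.CriticalPhenomena.CardyFormulaZ2.Cruxes.DualCurrentTemplateR.StrategistCensusR1

open scoped Classical
open Literature.Probability.LatticeModels Literature.Probability
open Summit.CriticalPhenomena.CardyFormulaZ2.Theses.CardyDualCurrent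
  (DualCurrentTemplateR NoDualCurrentRangeZero)
open Summit.CriticalPhenomena.CardyFormulaZ2.Cruxes.DualCurrentTemplateR (Birth.IsLocallyCR)

/-! ### §0  The two stubs of the sibling negation line, verbatim -/

/-- VERBATIM `LocalNecessity.Sig.stub_localNecessity` (line `local_necessity` of crux r4): an exactly
CR template is locally CR. -/
def LocalNecessity : Prop :=
  ∀ T : LocalParafermionicTemplate, T.IsExactCR → Birth.IsLocallyCR T

/-- VERBATIM `LocalNecessity.Sig.stub_conjectureH` (Conjecture H, constancy form). -/
def ConjectureH : Prop :=
  ∀ T : LocalParafermionicTemplate, Birth.IsLocallyCR T →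
    ∀ D : DiscreteDobrushin, D.IsZdAdmissible →
      ((discreteDomainGraph D.Ω D.δ).induce D.zdArcA).Preconnected → T.IsConstantIn D

/-! ### §1  The law-span dichotomy: every positive line is `birth` or a refutation of local necessity -/

/-- A LOCAL witness: locally Cauchy–Riemann (block resummation of the CR defect vanishes for every
exterior) and non-degenerate — the object line `birth` searches for. -/
def LocalWitness : Prop :=
  ∃ T : LocalParafermionicTemplate, Birth.IsLocallyCR T ∧ T.Nondegenerate

/-- A GLOBAL-CANCELLATION witness: exactly CR in every admissible domain WITHOUT being locally CR
(the identities hold only after averaging over exterior interface data), and non-degenerate. -/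
def GlobalCancellationWitness : Prop :=
  ∃ T : LocalParafermionicTemplate, T.IsExactCR ∧ ¬ Birth.IsLocallyCR T ∧ T.Nondegenerate

/-- **Dichotomy.** The crux holds iff there is a local witness or a global-cancellation witness
(excluded middle on `IsLocallyCR` of the witness; the local ⇒ exact direction is the landed
`Birth.isExactCR_of_isLocallyCR`). -/
theorem crux_iff_local_or_global :
    DualCurrentTemplateR ↔ LocalWitness ∨ GlobalCancellationWitness := by
  constructor
  · intro h
    obtain ⟨T, hCR, hND⟩ :=
      LocalParafermionicTemplate.exists_isExactCR_and_nondegenerate_iff.2 h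
    by_cases hloc : Birth.IsLocallyCR T
    · exact Or.inl ⟨T, hloc, hND⟩
    · exact Or.inr ⟨T, hCR, hloc, hND⟩
  · rintro (⟨T, hloc, hND⟩ | ⟨T, hCR, -, hND⟩)
    · exact LocalParafermionicTemplate.exists_isExactCR_and_nondegenerate_iff.1
        ⟨T, Birth.isExactCR_of_isLocallyCR Birth.stub_blockResummation
          Birth.stub_integrandIntegrable T hloc, hND⟩
    · exact LocalParafermionicTemplate.exists_isExactCR_and_nondegenerate_iff.1 ⟨T, hCR, hND⟩

/-- A global-cancellation witness is exactly a counterexample to stub 1 (`stub_localNecessity`) of the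
sibling negation line `local_necessity`: any positive line for r2 that is not `birth` must refute it. -/
theorem not_localNecessity_of_globalCancellationWitness :
    GlobalCancellationWitness → ¬ LocalNecessity :=
  fun ⟨T, hCR, hloc, _⟩ h₁ => hloc (h₁ T hCR)

/-- Conversely, under local necessity the crux IS the local witness (so `birth` is then complete). -/
theorem crux_iff_localWitness_of_localNecessity (h₁ : LocalNecessity) :
    DualCurrentTemplateR ↔ LocalWitness := by
  rw [crux_iff_local_or_global]
  constructor
  · rintro (h | ⟨T, hCR, hloc, _⟩)
    · exact h
    · exact (hloc (h₁ T hCR)).elim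
  · exact Or.inl

/-- And under both stubs of `local_necessity` the crux fails (the sibling line's decision value,
re-proved here from the verbatim signatures). -/
theorem not_crux_of_localNecessity_of_conjectureH (h₁ : LocalNecessity)
    (h₂ : ConjectureH) : ¬ DualCurrentTemplateR := fun hR => by
  obtain ⟨T, hCR, hND⟩ :=
    LocalParafermionicTemplate.exists_isExactCR_and_nondegenerate_iff.2 hR
  exact hND (h₂ T (h₁ T hCR))

/-! ### §2  Strengthen: typed sub-classes `S⁺ ⇒ crux` -/

/-- `S⁺_σ`: a witness all of whose spins equal one value `σ` (pure spin sector; `σ = 1/3` is the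
printed parafermion's sector, `σ = 1` the current sector). -/
def PureSpinWitness (σ : ℝ) : Prop :=
  ∃ T : LocalParafermionicTemplate, (∀ i k, T.s i k = σ) ∧ T.IsExactCR ∧ T.Nondegenerate

/-- `S⁺_pf`: a PATTERN-FREE witness (the local weights do not read the configuration: the observable
is a finite combination of shifted pure parafermionic observables). -/
def PatternFreeWitness : Prop :=
  ∃ T : LocalParafermionicTemplate, (∀ i k A, T.g i k A = T.g i k ∅) ∧ T.IsExactCR ∧ T.Nondegenerate

/-- `S⁺_loc(ρ₀)`: a local witness with block radius at most `ρ₀` (the census cells). -/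
def LocalWitnessRadius (ρ₀ : ℕ) : Prop :=
  ∃ T : LocalParafermionicTemplate, T.Nondegenerate ∧
    ∃ ρ ≤ ρ₀, ∀ D : DiscreteDobrushin, D.IsZdAdmissible →
      ((discreteDomainGraph D.Ω D.δ).induce D.zdArcA).Preconnected →
      (∀ x, T.IsDeep D x 0 → T.IsDeep D x 1 → T.IsDeep D (x - Pi.single 0 1) 0 →
          T.IsDeep D (x - Pi.single 1 1) 1 →
        ∀ ω, Birth.blockSum (Birth.edgeBox x ρ) (fun ω' => Birth.vertexDefect T D ω' x) ω = 0) ∧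
      (∀ f, T.IsDeep D f 0 → T.IsDeep D (f + Pi.single 1 1) 0 → T.IsDeep D f 1 →
          T.IsDeep D (f + Pi.single 0 1) 1 →
        ∀ ω, Birth.blockSum (Birth.edgeBox f ρ) (fun ω' => Birth.faceDefect T D ω' f) ω = 0)

theorem crux_of_pureSpinWitness (σ : ℝ) : PureSpinWitness σ → DualCurrentTemplateR :=
  fun ⟨T, _, hCR, hND⟩ =>
    LocalParafermionicTemplate.exists_isExactCR_and_nondegenerate_iff.1 ⟨T, hCR, hND⟩

theorem crux_of_patternFreeWitness : PatternFreeWitness → DualCurrentTemplateR :=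
  fun ⟨T, _, hCR, hND⟩ =>
    LocalParafermionicTemplate.exists_isExactCR_and_nondegenerate_iff.1 ⟨T, hCR, hND⟩

theorem localWitness_of_localWitnessRadius (ρ₀ : ℕ) : LocalWitnessRadius ρ₀ → LocalWitness :=
  fun ⟨T, hND, ρ, _, hρ⟩ => ⟨T, ⟨ρ, hρ⟩, hND⟩

theorem crux_of_localWitnessRadius (ρ₀ : ℕ) : LocalWitnessRadius ρ₀ → DualCurrentTemplateR :=
  fun h => crux_iff_local_or_global.2 (Or.inl (localWitness_of_localWitnessRadius ρ₀ h))

/-! ### §3  Decomposition: domain-class sufficiency `WitnessOn 𝒟 → ClassSuffices 𝒟 → crux` -/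

/-- Exact CR asked only in the domains of a class `𝒟` (intended instance: the three-sided boxes /
bar domains `LatticeDobrushinBox.threeSided`, `barDomain` of the lead's census). -/
def IsExactCROn (𝒟 : Set DiscreteDobrushin) (T : LocalParafermionicTemplate) : Prop :=
  ∀ D ∈ 𝒟, D.IsZdAdmissible →
    ((discreteDomainGraph D.Ω D.δ).induce D.zdArcA).Preconnected → T.IsExactCRIn D

/-- Sub₁: a non-degenerate template exactly CR on the class. -/
def WitnessOn (𝒟 : Set DiscreteDobrushin) : Prop :=
  ∃ T : LocalParafermionicTemplate, IsExactCROn 𝒟 T ∧ T.Nondegenerate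

/-- Sub₂: the class suffices — exact CR on `𝒟` forces exact CR in every admissible domain. -/
def ClassSuffices (𝒟 : Set DiscreteDobrushin) : Prop :=
  ∀ T : LocalParafermionicTemplate, IsExactCROn 𝒟 T → T.IsExactCR

/-- Glue of the split (modus ponens). -/
theorem crux_of_classSplit (𝒟 : Set DiscreteDobrushin) :
    WitnessOn 𝒟 → ClassSuffices 𝒟 → DualCurrentTemplateR :=
  fun ⟨T, hOn, hND⟩ hS =>
    LocalParafermionicTemplate.exists_isExactCR_and_nondegenerate_iff.1 ⟨T, hS T hOn, hND⟩

/-- Exact CR everywhere restricts to any class (so `WitnessOn 𝒟` is NECESSARY for the crux: Sub₁ is a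
weakening of the crux's search, not a different problem). -/
theorem witnessOn_of_crux (𝒟 : Set DiscreteDobrushin) : DualCurrentTemplateR → WitnessOn 𝒟 :=
  fun h => by
    obtain ⟨T, hCR, hND⟩ :=
      LocalParafermionicTemplate.exists_isExactCR_and_nondegenerate_iff.2 h
    exact ⟨T, fun D _ hD hA => hCR D hD hA, hND⟩

/-- `ClassSuffices 𝒟` follows from local necessity RELATIVE TO THE CLASS (exact CR on `𝒟` already
forces local CR) — a statement at least as strong as `stub_localNecessity` (fewer domains to realise
exterior data with), which is why Sub₂ has no handle that N1 lacks. -/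
theorem classSuffices_of_localNecessityOn (𝒟 : Set DiscreteDobrushin)
    (h : ∀ T : LocalParafermionicTemplate, IsExactCROn 𝒟 T → Birth.IsLocallyCR T) :
    ClassSuffices 𝒟 :=
  fun T hOn => Birth.isExactCR_of_isLocallyCR Birth.stub_blockResummation
    Birth.stub_integrandIntegrable T (h T hOn)

/-! ### §4  Transfer toy: the spin-1 CURRENT sector at range 0 is already decided by the route's r9 census item -/

/-- The pure spin-1 range-0 template (the interface CURRENT through the base medial vertex:
`passageSum` with phase `exp(-i·1·W)` = direction of passage) is Smirnov's template at `σ = 1`; it has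
third-spins (`1 = 3/3`), so the route's support item `NoDualCurrentRangeZero` (census: exact-CR kernel
`{0}` at range 0, job j017402; item stmt-CriticalPhenomena-11204, open) already says it is not a
witness: the expected current of the percolation interface is NOT exactly irrotational-and-nondegenerate. -/
theorem current_not_witness_of_noRangeZero
    (h : ¬ ∃ T : LocalParafermionicTemplate,
        T.r = 0 ∧ T.HasThirdSpins ∧ T.IsExactCR ∧ T.Nondegenerate) :
    ¬ ((LocalParafermionicTemplate.smirnov 1).IsExactCR ∧
        (LocalParafermionicTemplate.smirnov 1).Nondegenerate) :=
  fun ⟨h1, h2⟩ => h ⟨LocalParafermionicTemplate.smirnov 1, rfl,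
    fun _ _ => ⟨3, by show (1 : ℝ) = ((3 : ℤ) : ℝ) / 3; norm_num⟩, h1, h2⟩

/-- The same, fed by the route item `NoDualCurrentRangeZero` itself through the Literature
re-bracketing `not_exists_thirdSpins_iff 0`. -/
theorem current_not_witness (h : NoDualCurrentRangeZero) :
    ¬ ((LocalParafermionicTemplate.smirnov 1).IsExactCR ∧
        (LocalParafermionicTemplate.smirnov 1).Nondegenerate) :=
  current_not_witness_of_noRangeZero ((LocalParafermionicTemplate.not_exists_thirdSpins_iff 0).2 h)

end Summit.CriticalPhenomena.CardyFormulaZ2.Cruxes.DualCurrentTemplateR.StrategistCensusR1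

end
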